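import Mathlib
import HarnessLib

/-!
# `NoHeavyLowerTail` (crux stmt-CriticalPhenomena-4575), antithetic vdBHK programme: the BROOM REDUCTION of CONJECTURE HB — combinatorial skeleton

Support file (seat `prim-ineq-gen-7` gen 35; `--supports stmt-CriticalPhenomena-4575`).  Nothing is asserted about the crux; no `sorry`.
Memo: run/shared/lean/prim/prim-ineq-gen-7/FINDING-CAT-g35.md (NM-BROOM lemma, THEOREM SP4, the depth-`k` J-rule calculus and the
BROOM REDUCTION THEOREM), building on FINDING-NECK1-g34.md (J-rule, H-rule, pair potentials) and FINDING-SPIDER-g33.md (THEOREM SP).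

CONTEXT.  CONJECTURE HB asks for `HUB⁺(F_v(T₂)) ≥ 0` for every root-degree-1 tree `T₂ = f + E`, `E` the rooted forest hanging at the lower
end `w` of the root edge `f`.  Writing `I_k(E)` for the depth-`k` statement '`k`-th mixed difference of `HUB⁺` over `k` added leaves at `w` is
nonnegative on `F_{E ⊔ k leaves}`' (`I_0` = HB itself, `I_1` = neck monotonicity `NM ≥ 0`), the J-RULE of FINDING-NECK1-g34 §1b and its
depth-`k` version (FINDING-CAT-g35 §4) read, for a forest `E = B ⊔ (g + E'')` (one component singled out, `g` its top edge, `E''` the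
forest below `g`):
                    `I_{k+1}(B) ∧ I_k(B ⊔ E'') ⟹ I_k(B ⊔ (g + E''))`.
Adding a LEAF is the case `E'' = ∅`.  This file isolates the purely combinatorial content of the reduction:

* `AntitheticBroomReduction.reduction` — if the J-rule holds at every depth and `I_k(∅)` holds for every `k` (the depth-`k` level lemmas at the
  one-edge structure), then `I_k(E)` holds for every forest `E` and every `k`; in particular HB for every root-degree-1 `T₂`
  (the 'r = 0 tower' form of the BROOM REDUCTION THEOREM).
* `AntitheticBroomReduction.reduction_two` — the form actually used: a 'plain' predicate `P` (goal `P 0`) and a potential-corrected predicate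
  `Q` (`Q 1 ⟹ P 1`), each closed under its J-rule, with bases `P 0 ∅` and `Q k ∅` (`k ≥ 1`), give `P 0 E` for all `E`.
* `AntitheticBroomReduction.caterpillar` — the finite-depth instance proved in gen 35 (THEOREM SP4-CAT): from `I_0` on leaf forests
  (THEOREM SP-BROOM), `I_1` on leaf forests (the NM-BROOM lemma, DRAT-certified) and the depth-0 J-rule, `I_0` holds for every CATERPILLAR
  forest (leaves at the current vertex plus one continuing component, recursively).

Forests are lists of rooted trees, a rooted tree is the list of its children (`RTree.node`); `B ⊔ (g + E'')` is `RTree.node E'' :: B` and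
`B ⊔ E''` is `B ++ E''`.  The induction is on the number of edges.
-/

namespace Summit.CriticalPhenomena.PercolationContinuityZ3.Theorems

namespace AntitheticBroomReduction

/-- A rooted tree, given by the forest of its children (the tree `g + E''` whose top edge `g` carries the forest `E''` below it).
[this work] -/
inductive RTree : Type
  | node : List RTree → RTree

/-- Number of edges of a rooted tree / of a forest (a component `g + E''` has `1 + |E''|` edges). [this work] -/
def RTree.edges : RTree → ℕ
  | .node cs => 1 + (cs.map RTree.edges).sum

/-- Number of edges of a forest. [this work] -/
def fedges (E : List RTree) : ℕ := (E.map RTree.edges).sum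

/-- Edge count of a cons. [this work] -/
theorem fedges_cons (t : RTree) (B : List RTree) : fedges (t :: B) = t.edges + fedges B := by
  simp [fedges]

/-- Edge count of an append. [this work] -/
theorem fedges_append (B E : List RTree) : fedges (B ++ E) = fedges B + fedges E := by
  simp [fedges, List.map_append, List.sum_append]

/-- Edge count of a component. [this work] -/
theorem edges_node (E : List RTree) : (RTree.node E).edges = 1 + fedges E := by
  simp [RTree.edges, fedges]

/-- **BROOM REDUCTION, tower form** (FINDING-CAT-g35 §4).  If the depth-`k` statements `I k` satisfy the J-rule
`I (k+1) B → I k (B ++ E'') → I k (node E'' :: B)` at every depth and hold on the empty forest at every depth (the depth-`k` level lemmas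
of the one-edge structure), then they hold for every forest at every depth.  Induction on the number of edges. [this work] -/
theorem reduction (I : ℕ → List RTree → Prop) (base : ∀ k, I k [])
    (jrule : ∀ k (B E : List RTree), I (k + 1) B → I k (B ++ E) → I k (RTree.node E :: B)) :
    ∀ (E : List RTree) (k : ℕ), I k E := by
  suffices h : ∀ n (E : List RTree), fedges E = n → ∀ k, I k E from fun E k => h _ E rfl k
  intro n
  induction n using Nat.strong_induction_on with
  | _ n ih =>
    intro E hE k
    match E with
    | [] => exact base k
    | (RTree.node E'') :: B =>
      have hsz : fedges (RTree.node E'' :: B) = 1 + fedges E'' + fedges B := by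
        rw [fedges_cons, edges_node]
      apply jrule
      · exact ih (fedges B) (by omega) B rfl (k + 1)
      · exact ih (fedges (B ++ E'')) (by rw [fedges_append]; omega) (B ++ E'') rfl k

/-- **BROOM REDUCTION, two-predicate form** (FINDING-CAT-g35 §4, the form used with pair potentials).  `P k` = plain depth-`k` statement
(`P 0` = HB), `Q k` = potential-corrected depth-`k` statement (`k ≥ 1`; `Q 1 → P 1` because potentials are nonnegative).  If both are closed
under their J-rules, `P 0 []` holds (BASE lemma of the one-edge structure) and `Q k []` holds for all `k ≥ 1` (depth-`k` level lemmas with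
potentials: `k = 1` BASE₁, `k = 2` LEVEL₁ = THEOREM SP3, `k ≥ 3` open), then `P 0 E` for every forest `E`, i.e. CONJECTURE HB for every
root-degree-1 second leg. [this work] -/
theorem reduction_two (P Q : ℕ → List RTree → Prop) (baseP : P 0 []) (baseQ : ∀ k, 1 ≤ k → Q k [])
    (jruleP : ∀ (B E : List RTree), P 1 B → P 0 (B ++ E) → P 0 (RTree.node E :: B))
    (jruleQ : ∀ k (B E : List RTree), 1 ≤ k → Q (k + 1) B → Q k (B ++ E) → Q k (RTree.node E :: B))
    (bridge : ∀ E, Q 1 E → P 1 E) : ∀ E : List RTree, P 0 E := by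
  -- all Q k, k ≥ 1, by the tower form applied to Q' k := Q (k+1)
  have hQ : ∀ (E : List RTree) (k : ℕ), Q (k + 1) E := by
    refine reduction (fun k E => Q (k + 1) E) (fun k => baseQ (k + 1) (by omega)) ?_
    intro k B E h1 h2
    exact jruleQ (k + 1) B E (by omega) h1 h2
  -- then P 0 by induction on edges using the bridge for the depth-1 premise
  suffices h : ∀ n (E : List RTree), fedges E = n → P 0 E from fun E => h _ E rfl
  intro n
  induction n using Nat.strong_induction_on with
  | _ n ih =>
    intro E hE
    match E with
    | [] => exact baseP
    | (RTree.node E'') :: B =>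
      have hsz : fedges (RTree.node E'' :: B) = 1 + fedges E'' + fedges B := by
        rw [fedges_cons, edges_node]
      apply jruleP
      · exact bridge B (hQ B 0)
      · exact ih (fedges (B ++ E'')) (by rw [fedges_append]; omega) (B ++ E'') rfl

/-- The CATERPILLAR forests (FINDING-CAT-g35 §2), as explicit derivation trees (data, not a `Prop`): a bunch of leaves, or a bunch of
leaves together with ONE further component `g + E''` whose lower forest `E''`, thrown together with the leaves, is again a caterpillar
forest (so `f + E` is a caterpillar rooted at an end of its spine). [this work] -/
inductive IsCat : List RTree → Type
  | leaves (r : ℕ) : IsCat (List.replicate r (RTree.node []))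
  | grow (r : ℕ) (E'' : List RTree) :
      IsCat (List.replicate r (RTree.node []) ++ E'') → IsCat (RTree.node E'' :: List.replicate r (RTree.node []))

/-- **THEOREM SP4-CAT, combinatorial skeleton** (FINDING-CAT-g35 §2).  From `I₀` on leaf forests (THEOREM SP-BROOM: `HUB⁺(F_v(broom_r)) ≥ 0`),
`I₁` on leaf forests (the NM-BROOM lemma: neck monotonicity of every broom slice, DRAT-certified) and the depth-0 J-rule
(`I₁(B) ∧ I₀(B ⊔ E'') ⟹ I₀(B ⊔ (g + E''))`, FINDING-NECK1-g34 §1b), `I₀` — i.e. CONJECTURE HB — holds for every caterpillar forest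
(every forest carrying a caterpillar derivation). [this work] -/
theorem caterpillar (I0 I1 : List RTree → Prop) (base0 : ∀ r, I0 (List.replicate r (RTree.node [])))
    (base1 : ∀ r, I1 (List.replicate r (RTree.node [])))
    (jrule : ∀ (B E : List RTree), I1 B → I0 (B ++ E) → I0 (RTree.node E :: B))
    (E : List RTree) (h : IsCat E) : I0 E := by
  induction h with
  | leaves r => exact base0 r
  | grow r E'' _ ih => exact jrule _ _ (base1 r) ih

/-- The two-branch families of gen 34/35 in the same language: if additionally `I₁` holds for every hanging PATH `P_b` (g34: H-rule from BASE₁,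
THEOREM SP3's ingredient), then `I₀` holds for 'a path `P_b` next to a component `g + E''`' whenever it holds for `P_b ⊔ E''`
— the recursion behind the double-broom / 3-leg-spider families (FINDING-CAT-g35 §2c). [this work] -/
theorem path_slice (I0 I1 : List RTree → Prop) (P : ℕ → RTree) (base1 : ∀ b, I1 [P b])
    (jrule : ∀ (B E : List RTree), I1 B → I0 (B ++ E) → I0 (RTree.node E :: B)) (b : ℕ) (E : List RTree)
    (h : I0 ([P b] ++ E)) : I0 (RTree.node E :: [P b]) :=
  jrule [P b] E (base1 b) h

end AntitheticBroomReduction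

end Summit.CriticalPhenomena.PercolationContinuityZ3.Theorems
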